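import Summits.QuantumFields.YangMills.Theses.IsotropyFromPowerCounting
import Summits.QuantumFields.YangMills.Theorems.IsotropyFromPowerCountingEngineFromPowerCounting
import Summits.QuantumFields.YangMills.Theorems.MirrorModularBoostsPlanarSpectralCone
import HarnessLib

/-!
# `IsotropyFromPowerCounting.Assembly` — the assembly item of route `IsotropyFromPowerCounting`

Route `IsotropyFromPowerCounting` (sub-problem `YangMills` of summit `QuantumFields`) files, as its
assembly item `Assembly` (stmt-QuantumFields-17724; restated BY NAME 2026-08-31 as
stmt-QuantumFields-27396 after the FOLD, shape F), the implication chain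

`CurvatureSandwichBound → TemperedCurvatureMoments → CurvatureKernelBound →
 WeakCouplingHypercubicLimitRP → YangMills` (FOLD 2026-08-31).

This is the type of the route's deciding theorem
`Summit.QuantumFields.YangMills.Theses.IsotropyFromPowerCounting.closes` with its two CERTIFIED
binders discharged by their landed proofs:

* `E = EngineFromPowerCounting` (`T → Σ → B′`, stmt-QuantumFields-17722, closed `proved`) by
  `Summit.QuantumFields.YangMills.Theorems.SoftKernelBoostCovariance.Sketch.engineFromPowerCounting_proof`
  (`Theorems/IsotropyFromPowerCountingEngineFromPowerCounting.lean`);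
* `C = PlanarSpectralCone` (stmt-QuantumFields-18313, the verbatim refiling of `MirrorModularBoosts`'
  stmt-QuantumFields-9664) by
  `Summit.QuantumFields.YangMills.Cruxes.PlanarSpectralCone.PositivityDiscToOperatorCone.PlanarSpectralCone_of`
  (`Theorems/MirrorModularBoostsPlanarSpectralCone.lean`), which proves
  `MirrorModularBoosts.PlanarSpectralCone`; the two definitions have byte-identical bodies, so the
  term is accepted up to `δ`-unfolding (recorded here as `isotropyFromPowerCounting_planarSpectralCone_proof`).

The deciding theorem keeps `E` and `C` as binders only to keep the fact-laden import cones of their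
proof modules out of the route file; a `Theorems` file may import them, and this one does. The file
adds no mathematics of its own.

Sources: route-internal (`closes`, `engineFromPowerCounting_proof`, `PlanarSpectralCone_of`);
Osterwalder–Schrader 1975 and Jaffe–Witten 2000 for the axioms packaged in `YangMills`.
Deliberately NOT here: any of the five cruxes `CurvatureSandwichBound`, `TemperedCurvatureMoments`,
`CurvatureKernelBound`, `DiagonalMirrorRPR`, `WeakCouplingHypercubicLimit` — they stay hypotheses.
-/

namespace Summit.QuantumFields.YangMills.Theorems

/-- **`IsotropyFromPowerCounting.PlanarSpectralCone` holds** (the certified binder `C`,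
stmt-QuantumFields-18313): it is, up to unfolding, the landed theorem
`Cruxes.PlanarSpectralCone.PositivityDiscToOperatorCone.PlanarSpectralCone_of` for the byte-identical
statement `MirrorModularBoosts.PlanarSpectralCone` (stmt-QuantumFields-9664). [folklore] -/
theorem isotropyFromPowerCounting_planarSpectralCone_proof :
    Summit.QuantumFields.YangMills.Theses.IsotropyFromPowerCounting.PlanarSpectralCone := by
  unfold Summit.QuantumFields.YangMills.Theses.IsotropyFromPowerCounting.PlanarSpectralCone
  exact Summit.QuantumFields.YangMills.Cruxes.PlanarSpectralCone.PositivityDiscToOperatorCone.PlanarSpectralCone_of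

/-- **`IsotropyFromPowerCounting.Assembly` holds** (assembly item stmt-QuantumFields-27396, the by-name
restatement of stmt-QuantumFields-17724 after the FOLD): the chain
`CurvatureSandwichBound → TemperedCurvatureMoments → CurvatureKernelBound → WeakCouplingHypercubicLimitRP →
YangMills` (FOLD 2026-08-31: four hypotheses).
Proof: after unfolding, feed the four hypotheses to the route's sorry-free deciding theorem
`IsotropyFromPowerCounting.closes`, discharging its two certified binders by the landed
`engineFromPowerCounting_proof` (E) and `isotropyFromPowerCounting_planarSpectralCone_proof` (C).
[folklore] -/
theorem isotropyFromPowerCounting_assembly_proof :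
    Summit.QuantumFields.YangMills.Theses.IsotropyFromPowerCounting.Assembly := by
  unfold Summit.QuantumFields.YangMills.Theses.IsotropyFromPowerCounting.Assembly
  intro hSig hT hK hH
  exact Summit.QuantumFields.YangMills.Theses.IsotropyFromPowerCounting.closes hSig hT hK hH
    Summit.QuantumFields.YangMills.Theorems.SoftKernelBoostCovariance.Sketch.engineFromPowerCounting_proof
    isotropyFromPowerCounting_planarSpectralCone_proof

end Summit.QuantumFields.YangMills.Theorems
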